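import Literature.NumberTheory.LFunctions.CertifiedDirichletLTuringMethod
import Literature.NumberTheory.LFunctions.DirichletLFunctionBounds
import HarnessLib

/-!
# Booker's Euler-product envelope for Dirichlet `L`-functions (Exp. Math. 15 (2006), Lemma 4.5,
# degree one) — proofs only

Topic `Literature/NumberTheory/LFunctions`; namespace `Literature.NumberTheory.LFunctions.Booker2006Turing`.
Companion of `CertifiedDirichletLTuringMethod.lean`, which DEFINES Booker's `z₀(σ) = ζ(2σ)/ζ(σ)`
(`smallZ`), `Z₀(σ) = ζ(σ)` (`bigZ`) and the Turing constant `c₀` (`turingConst`) of Theorem 4.6 and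
vendors Theorem 4.6 (degree one) as the named fact `booker2006_theorem46_dirichlet`. Here the lemma
those constants come from is PROVED for Dirichlet `L`-functions (no definitions, no named facts —
D-0026; everything below is a theorem with the standard axioms):

Booker 2006, **Lemma 4.5** (journal p. 396; arXiv:math/0507502 Lemma 7), as printed: "For
`σ > θ + 1`, define `z_θ(σ) := (ζ(2σ+2θ)ζ(2σ−2θ)/(ζ(σ+θ)ζ(σ−θ)))^{1/2}` and
`Z_θ(σ) := (ζ(σ+θ)ζ(σ−θ))^{1/2}`. Then
`r (z_θ'/z_θ)(σ) ≥ Re (L'/L)(σ + it) ≥ r (Z_θ'/Z_θ)(σ)` (4–11) and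
`z_θ(σ)^r ≤ |L(σ + it)| ≤ Z_θ(σ)^r` (4–12)." ("From the Euler product … each summand is `≤ 0` …
For (4–12), integrate (4–11) from `σ` to `∞`.") For `L = L(·, χ)`, `χ` a Dirichlet character
(`r = 1`, Ramanujan exponent `θ = 0`, `|χ(p)| ≤ 1`):

* `norm_LFunction_le_bigZ` — **(4–12), upper:** `‖L(σ + it, χ)‖ ≤ Z₀(σ) = ζ(σ)` for `σ > 1`;
* `smallZ_le_norm_LFunction` — **(4–12), lower:** `z₀(σ) = ζ(2σ)/ζ(σ) ≤ ‖L(σ + it, χ)‖` for `σ > 1`;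
* `logDeriv_bigZ_le_re_logDeriv_LFunction` — **(4–11), lower:** `(Z₀'/Z₀)(σ) = ζ'(σ)/ζ(σ) ≤
  Re (L'/L)(σ + it, χ)` for `σ > 1`;

proved directly from the Euler products of Mathlib (`DirichletCharacter.LSeries_eulerProduct`,
`riemannZeta_eulerProduct`: finite partial products over `primesBelow n`, factor-by-factor
comparison `(1 + p^{−σ})^{−1} ≤ |(1 − χ(p)p^{−s})^{−1}| ≤ (1 − p^{−σ})^{−1}` and
`(1 + x)^{−1} = (1 − x²)^{−1}/(1 − x)^{−1}`, then limits) and, for (4–11), from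
`−L'/L(s, χ) = Σ χ(n)Λ(n)n^{−s}` dominated termwise by `Σ Λ(n)n^{−σ} = −ζ'/ζ(σ)` (the tree's
`DirichletZFR.neg_logDeriv_LFunction_eq`, `DirichletZFR.norm_LSeries_twist_le`). Valid for every
Dirichlet character, primitive or not (the missing Euler factors are `1`, inside the envelope), which
is how Booker's class (§1.3, "exceptional `p`") covers imprimitive `L`. Also proved, as API for the
definitions of the companion file: `bigZ_eq_norm`, `one_le_bigZ`, `bigZ_pos`, `smallZ_eq_div`,
`smallZ_pos`, `smallZ_le_one`, `deriv_bigZ` (helpers about the real Euler products of `ζ` are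
`private`).

* `re_logDeriv_LFunction_le_logDeriv_smallZ` (appended) — **(4–11), upper:**
  `Re (L'/L)(σ + it, χ) ≤ (z₀'/z₀)(σ) = 2ζ'/ζ(2σ) − ζ'/ζ(σ)` for `σ > 1` (prime by prime after
  summing the geometric series — `Re(w/(1 − w)) ≥ −x/(1 + x)` for `|w| ≤ x < 1` —, the regrouping
  over primes being Mathlib's `tsum_eq_tsum_primes_of_support_subset_prime_powers`), with
  `deriv_smallZ_div_smallZ` and the two-sided `logDeriv_envelope`;

NOT proved here: the general degree-`r`, `θ > 0` form of the lemma (Booker's class §1.3 is not a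
Mathlib object).

## References

* [Booker2006] A. R. Booker, *Artin's conjecture, Turing's method, and the Riemann hypothesis*,
  Experiment. Math. 15 (2006) 385–407, §4 Lemma 4.5 ((4–11), (4–12)) p. 396; arXiv:math/0507502
  Lemma 7 (`paper:arxiv-math_0507502`, chunk 14).
-/

noncomputable section

open Complex Filter Topology Finset
open scoped Real LSeries.notation ArithmeticFunction.vonMangoldt

namespace Literature.NumberTheory.LFunctions

namespace Booker2006Turing

/-! ### Euler factors: the factor-by-factor comparison -/

/-- For a prime `p`, `σ = Re s > 0` and `|a| ≤ 1`: `‖a · p^{−s}‖ ≤ p^{−σ} < 1`. [folklore] -/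
private theorem norm_mul_cpow_neg_le_rpow {p : ℕ} (hp : p.Prime) {a : ℂ} (ha : ‖a‖ ≤ 1) (s : ℂ) :
    ‖a * (p : ℂ) ^ (-s)‖ ≤ (p : ℝ) ^ (-s.re) := by
  rw [norm_mul, Complex.norm_natCast_cpow_of_pos hp.pos, Complex.neg_re]
  calc ‖a‖ * (p : ℝ) ^ (-s.re) ≤ 1 * (p : ℝ) ^ (-s.re) := by
        gcongr
    _ = (p : ℝ) ^ (-s.re) := one_mul _

/-- For a prime `p` and `σ > 0`: `p^{−σ} < 1`. [folklore] -/
private theorem rpow_neg_lt_one {p : ℕ} (hp : p.Prime) {σ : ℝ} (hσ : 0 < σ) : (p : ℝ) ^ (-σ) < 1 :=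
  Real.rpow_lt_one_of_one_lt_of_neg (by exact_mod_cast hp.one_lt) (by linarith)

/-- Upper comparison of one Euler factor: `‖(1 − a p^{−s})^{−1}‖ ≤ (1 − p^{−σ})^{−1}` for
`|a| ≤ 1`, `σ = Re s > 0`. [cite: Booker2006, §4 Lemma 4.5 p. 396 (proof, "from the Euler product")] -/
theorem norm_eulerFactor_inv_le {p : ℕ} (hp : p.Prime) {a : ℂ} (ha : ‖a‖ ≤ 1) {s : ℂ}
    (hs : 0 < s.re) : ‖(1 - a * (p : ℂ) ^ (-s))⁻¹‖ ≤ (1 - (p : ℝ) ^ (-s.re))⁻¹ := by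
  have hx1 := rpow_neg_lt_one hp hs
  have hle := norm_mul_cpow_neg_le_rpow hp ha s
  have hlow : 1 - (p : ℝ) ^ (-s.re) ≤ ‖1 - a * (p : ℂ) ^ (-s)‖ := by
    have h := norm_sub_norm_le (1 : ℂ) (a * (p : ℂ) ^ (-s))
    rw [norm_one] at h
    linarith
  rw [norm_inv]
  exact inv_anti₀ (by linarith) hlow

/-- Lower comparison of one Euler factor: `(1 + p^{−σ})^{−1} ≤ ‖(1 − a p^{−s})^{−1}‖` for
`|a| ≤ 1`, `σ = Re s > 0`. [cite: Booker2006, §4 Lemma 4.5 p. 396 (proof, "from the Euler product")] -/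
theorem inv_le_norm_eulerFactor_inv {p : ℕ} (hp : p.Prime) {a : ℂ} (ha : ‖a‖ ≤ 1) {s : ℂ}
    (hs : 0 < s.re) : (1 + (p : ℝ) ^ (-s.re))⁻¹ ≤ ‖(1 - a * (p : ℂ) ^ (-s))⁻¹‖ := by
  have hx1 := rpow_neg_lt_one hp hs
  have hle := norm_mul_cpow_neg_le_rpow hp ha s
  have hlow : 1 - (p : ℝ) ^ (-s.re) ≤ ‖1 - a * (p : ℂ) ^ (-s)‖ := by
    have h := norm_sub_norm_le (1 : ℂ) (a * (p : ℂ) ^ (-s))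
    rw [norm_one] at h
    linarith
  have hup : ‖1 - a * (p : ℂ) ^ (-s)‖ ≤ 1 + (p : ℝ) ^ (-s.re) := by
    have h := norm_sub_le (1 : ℂ) (a * (p : ℂ) ^ (-s))
    rw [norm_one] at h
    linarith
  rw [norm_inv]
  exact inv_anti₀ (by linarith) hup

/-! ### The real Euler products `∏_{p < n} (1 − p^{−σ})^{−1} → ζ(σ)` -/

/-- The partial Euler product of `ζ(σ)` over the primes below `n`, as a real number. [folklore] -/
private theorem ofReal_prod_primesBelow (σ : ℝ) (n : ℕ) :
    (((∏ p ∈ n.primesBelow, (1 - (p : ℝ) ^ (-σ))⁻¹ : ℝ)) : ℂ) =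
      ∏ p ∈ n.primesBelow, (1 - (p : ℂ) ^ (-(σ : ℂ)))⁻¹ := by
  push_cast
  refine Finset.prod_congr rfl fun p _ ↦ ?_
  rw [Complex.ofReal_cpow (Nat.cast_nonneg p) (-σ)]
  push_cast
  rfl

/-- `∏_{p < n} (1 − p^{−σ})^{−1} → Re ζ(σ)` for `σ > 1` (Mathlib's `riemannZeta_eulerProduct`, real
form). [folklore] -/
private theorem tendsto_prod_primesBelow_re {σ : ℝ} (hσ : 1 < σ) :
    Tendsto (fun n : ℕ ↦ ∏ p ∈ n.primesBelow, (1 - (p : ℝ) ^ (-σ))⁻¹) atTop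
      (𝓝 (riemannZeta σ).re) := by
  have hs : 1 < (σ : ℂ).re := by simp [hσ]
  have h := riemannZeta_eulerProduct hs
  have h' : Tendsto (fun n : ℕ ↦ (((∏ p ∈ n.primesBelow, (1 - (p : ℝ) ^ (-σ))⁻¹ : ℝ)) : ℂ))
      atTop (𝓝 (riemannZeta σ)) := by
    simpa only [ofReal_prod_primesBelow] using h
  have h'' := (Complex.continuous_re.tendsto _).comp h'
  exact h''.congr fun n ↦ Complex.ofReal_re _

/-- `Im ζ(σ) = 0` for real `σ > 1` (limit of real partial Euler products). [folklore] -/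
private theorem riemannZeta_ofReal_im_eq_zero' {σ : ℝ} (hσ : 1 < σ) : (riemannZeta σ).im = 0 := by
  have hs : 1 < (σ : ℂ).re := by simp [hσ]
  have h := riemannZeta_eulerProduct hs
  have h' : Tendsto (fun n : ℕ ↦ (((∏ p ∈ n.primesBelow, (1 - (p : ℝ) ^ (-σ))⁻¹ : ℝ)) : ℂ))
      atTop (𝓝 (riemannZeta σ)) := by
    simpa only [ofReal_prod_primesBelow] using h
  have h'' := (Complex.continuous_im.tendsto _).comp h'
  have h0 : Tendsto (fun _ : ℕ ↦ (0 : ℝ)) atTop (𝓝 (riemannZeta σ).im) :=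
    h''.congr fun n ↦ Complex.ofReal_im _
  exact tendsto_nhds_unique h0 tendsto_const_nhds

/-- `ζ(σ)` is the real number `Re ζ(σ)` for `σ > 1`. [folklore] -/
private theorem riemannZeta_ofReal_eq_re {σ : ℝ} (hσ : 1 < σ) :
    riemannZeta σ = ((riemannZeta σ).re : ℂ) :=
  Complex.ext (by simp) (by simp [riemannZeta_ofReal_im_eq_zero' hσ])

/-- Each partial product satisfies `1 ≤ ∏_{p < n} (1 − p^{−σ})^{−1}` (`σ > 0`). [folklore] -/
private theorem one_le_prod_primesBelow {σ : ℝ} (hσ : 0 < σ) (n : ℕ) :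
    1 ≤ ∏ p ∈ n.primesBelow, (1 - (p : ℝ) ^ (-σ))⁻¹ := by
  refine Finset.one_le_prod fun p hp ↦ ?_
  have hp' : p.Prime := (Nat.mem_primesBelow.1 hp).2
  have hx1 := rpow_neg_lt_one hp' hσ
  have hx0 : 0 ≤ (p : ℝ) ^ (-σ) := Real.rpow_nonneg (Nat.cast_nonneg p) _
  rw [← inv_one]
  exact inv_anti₀ (by linarith) (by linarith)

/-- `Z₀(σ) = Re ζ(σ) = ‖ζ(σ)‖` for `σ > 1`. [cite: Booker2006, §4 Lemma 4.5 p. 396] -/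
theorem bigZ_eq_norm {σ : ℝ} (hσ : 1 < σ) : bigZ σ = ‖riemannZeta σ‖ := by
  have h1 : 1 ≤ (riemannZeta σ).re :=
    ge_of_tendsto' (tendsto_prod_primesBelow_re hσ) (one_le_prod_primesBelow (by linarith))
  rw [bigZ, riemannZeta_ofReal_eq_re hσ, Complex.norm_real, Complex.ofReal_re,
    Real.norm_of_nonneg (by linarith)]

/-- `1 ≤ Z₀(σ)` for `σ > 1`. [cite: Booker2006, §4 Lemma 4.5 p. 396] -/
theorem one_le_bigZ {σ : ℝ} (hσ : 1 < σ) : 1 ≤ bigZ σ :=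
  ge_of_tendsto' (tendsto_prod_primesBelow_re hσ) (one_le_prod_primesBelow (by linarith))

/-- `0 < Z₀(σ)` for `σ > 1`. [cite: Booker2006, §4 Lemma 4.5 p. 396] -/
theorem bigZ_pos {σ : ℝ} (hσ : 1 < σ) : 0 < bigZ σ :=
  one_pos.trans_le (one_le_bigZ hσ)

/-- `∏_{p < n} (1 + p^{−σ})^{−1} → Re ζ(2σ) / Re ζ(σ) = z₀(σ)` for `σ > 1`, via
`(1 + x)^{−1} = (1 − x²)^{−1}/(1 − x)^{−1}`. [cite: Booker2006, §4 Lemma 4.5 p. 396] -/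
theorem tendsto_prod_primesBelow_inv_one_add {σ : ℝ} (hσ : 1 < σ) :
    Tendsto (fun n : ℕ ↦ ∏ p ∈ n.primesBelow, (1 + (p : ℝ) ^ (-σ))⁻¹) atTop
      (𝓝 ((riemannZeta (2 * σ : ℝ)).re / (riemannZeta σ).re)) := by
  have h2 := tendsto_prod_primesBelow_re (by linarith : 1 < 2 * σ)
  have h1 := tendsto_prod_primesBelow_re hσ
  have hne : (riemannZeta σ).re ≠ 0 := (bigZ_pos hσ).ne'
  refine (h2.div h1 hne).congr fun n ↦ ?_
  rw [Pi.div_apply, ← Finset.prod_div_distrib]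
  refine Finset.prod_congr rfl fun p hp ↦ ?_
  have hp' : p.Prime := (Nat.mem_primesBelow.1 hp).2
  have hx1 := rpow_neg_lt_one hp' (by linarith : 0 < σ)
  have hx0 : 0 ≤ (p : ℝ) ^ (-σ) := Real.rpow_nonneg (Nat.cast_nonneg p) _
  have hsq : (p : ℝ) ^ (-(2 * σ)) = ((p : ℝ) ^ (-σ)) ^ 2 := by
    rw [show (-(2 * σ)) = (-σ) * 2 by ring, Real.rpow_mul (Nat.cast_nonneg p)]
    norm_cast
  rw [hsq]
  have hA : 1 - (p : ℝ) ^ (-σ) ≠ 0 := by linarith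
  have hB : 1 + (p : ℝ) ^ (-σ) ≠ 0 := by linarith
  have hC : 1 - ((p : ℝ) ^ (-σ)) ^ 2 ≠ 0 := by
    have : 1 - ((p : ℝ) ^ (-σ)) ^ 2 = (1 - (p : ℝ) ^ (-σ)) * (1 + (p : ℝ) ^ (-σ)) := by ring
    rw [this]; exact mul_ne_zero hA hB
  field_simp
  ring

/-- `z₀(σ) = Z₀(2σ)/Z₀(σ) = Re ζ(2σ)/Re ζ(σ)` for `σ > 1` (`ζ` is real on `(1, ∞)`).
[cite: Booker2006, §4 Lemma 4.5 p. 396] -/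
theorem smallZ_eq_div {σ : ℝ} (hσ : 1 < σ) : smallZ σ = bigZ (2 * σ) / bigZ σ := by
  rw [smallZ, bigZ, bigZ]
  have h2 : riemannZeta (2 * (σ : ℂ)) = riemannZeta ((2 * σ : ℝ) : ℂ) := by push_cast; rfl
  rw [h2, riemannZeta_ofReal_eq_re hσ, Complex.div_ofReal_re, Complex.ofReal_re]

/-- `0 < z₀(σ)` for `σ > 1`. [cite: Booker2006, §4 Lemma 4.5 p. 396] -/
theorem smallZ_pos {σ : ℝ} (hσ : 1 < σ) : 0 < smallZ σ := by
  rw [smallZ_eq_div hσ]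
  exact div_pos (bigZ_pos (by linarith)) (bigZ_pos hσ)

/-- `z₀(σ) ≤ 1` for `σ > 1` (each factor `(1 + p^{−σ})^{−1} ≤ 1`). [cite: Booker2006, §4 Lemma 4.5 p. 396] -/
theorem smallZ_le_one {σ : ℝ} (hσ : 1 < σ) : smallZ σ ≤ 1 := by
  rw [smallZ_eq_div hσ, bigZ, bigZ]
  refine le_of_tendsto' (tendsto_prod_primesBelow_inv_one_add hσ) fun n ↦ ?_
  refine Finset.prod_le_one (fun p _ ↦ inv_nonneg.2 (by positivity)) fun p hp ↦ ?_
  have hx0 : 0 ≤ (p : ℝ) ^ (-σ) := Real.rpow_nonneg (Nat.cast_nonneg p) _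
  exact inv_le_one_of_one_le₀ (by linarith)

/-! ### Booker's Lemma 4.5, (4–12), for Dirichlet `L`-functions -/

variable {q : ℕ} [NeZero q]

/-- **Booker 2006, Lemma 4.5 (4–12), upper envelope, degree one:** for every Dirichlet character
`χ` mod `q`, `σ > 1` and real `t`, `|L(σ + it, χ)| ≤ Z₀(σ) = ζ(σ)`.
[cite: Booker2006, §4 Lemma 4.5 (4–12) p. 396] -/
theorem norm_LFunction_le_bigZ (χ : DirichletCharacter ℂ q) {σ : ℝ} (hσ : 1 < σ) (t : ℝ) :
    ‖χ.LFunction (σ + t * I)‖ ≤ bigZ σ := by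
  set s : ℂ := σ + t * I with hs_def
  have hs : 1 < s.re := by simp [hs_def, hσ]
  have hs0 : 0 < s.re := by linarith
  have hL := (DirichletCharacter.LSeries_eulerProduct χ hs).norm
  rw [← DirichletCharacter.LFunction_eq_LSeries χ hs] at hL
  refine le_of_tendsto_of_tendsto' hL (tendsto_prod_primesBelow_re hσ) fun n ↦ ?_
  rw [norm_prod]
  refine Finset.prod_le_prod (fun p _ ↦ norm_nonneg _) fun p hp ↦ ?_
  have hp' : p.Prime := (Nat.mem_primesBelow.1 hp).2
  have h := norm_eulerFactor_inv_le hp' (DirichletCharacter.norm_le_one χ (p : ZMod q)) hs0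
  simpa [hs_def] using h

/-- **Booker 2006, Lemma 4.5 (4–12), lower envelope, degree one:** for every Dirichlet character
`χ` mod `q`, `σ > 1` and real `t`, `z₀(σ) = ζ(2σ)/ζ(σ) ≤ |L(σ + it, χ)|`.
[cite: Booker2006, §4 Lemma 4.5 (4–12) p. 396] -/
theorem smallZ_le_norm_LFunction (χ : DirichletCharacter ℂ q) {σ : ℝ} (hσ : 1 < σ) (t : ℝ) :
    smallZ σ ≤ ‖χ.LFunction (σ + t * I)‖ := by
  set s : ℂ := σ + t * I with hs_def
  have hs : 1 < s.re := by simp [hs_def, hσ]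
  have hs0 : 0 < s.re := by linarith
  have hL := (DirichletCharacter.LSeries_eulerProduct χ hs).norm
  rw [← DirichletCharacter.LFunction_eq_LSeries χ hs] at hL
  have hz : smallZ σ = (riemannZeta (2 * σ : ℝ)).re / (riemannZeta σ).re := by
    rw [smallZ_eq_div hσ, bigZ, bigZ]
  rw [hz]
  refine le_of_tendsto_of_tendsto' (tendsto_prod_primesBelow_inv_one_add hσ) hL fun n ↦ ?_
  rw [norm_prod]
  refine Finset.prod_le_prod (fun p _ ↦ inv_nonneg.2 (by positivity)) fun p hp ↦ ?_
  have hp' : p.Prime := (Nat.mem_primesBelow.1 hp).2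
  have h := inv_le_norm_eulerFactor_inv hp' (DirichletCharacter.norm_le_one χ (p : ZMod q)) hs0
  simpa [hs_def] using h

/-- The envelope in one line: `z₀(σ) ≤ |L(σ + it, χ)| ≤ Z₀(σ)` (`σ > 1`).
[cite: Booker2006, §4 Lemma 4.5 (4–12) p. 396] -/
theorem smallZ_le_norm_LFunction_le_bigZ (χ : DirichletCharacter ℂ q) {σ : ℝ} (hσ : 1 < σ)
    (t : ℝ) : smallZ σ ≤ ‖χ.LFunction (σ + t * I)‖ ∧ ‖χ.LFunction (σ + t * I)‖ ≤ bigZ σ :=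
  ⟨smallZ_le_norm_LFunction χ hσ t, norm_LFunction_le_bigZ χ hσ t⟩

/-- In particular `L(σ + it, χ) ≠ 0` for `σ > 1` with the EXPLICIT lower bound `ζ(2σ)/ζ(σ) > 0`
(Mathlib has the non-vanishing; the envelope quantifies it). [cite: Booker2006, §4 Lemma 4.5 (4–12) p. 396] -/
theorem norm_LFunction_pos (χ : DirichletCharacter ℂ q) {σ : ℝ} (hσ : 1 < σ) (t : ℝ) :
    0 < ‖χ.LFunction (σ + t * I)‖ :=
  (smallZ_pos hσ).trans_le (smallZ_le_norm_LFunction χ hσ t)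

/-! ### Booker's Lemma 4.5, (4–11), lower inequality, for Dirichlet `L`-functions -/

/-- **Booker 2006, Lemma 4.5 (4–11), lower inequality, degree one:** for every Dirichlet character
`χ` mod `q`, `σ > 1` and real `t`, `Re (L'/L)(σ + it, χ) ≥ ζ'(σ)/ζ(σ) = (Z₀'/Z₀)(σ)`
(`−L'/L(s, χ) = Σ χ(n)Λ(n)n^{−s}` is dominated termwise by `Σ Λ(n)n^{−σ} = −ζ'/ζ(σ)`).
[cite: Booker2006, §4 Lemma 4.5 (4–11) p. 396] -/
theorem re_logDeriv_zeta_le_re_logDeriv_LFunction (χ : DirichletCharacter ℂ q) {σ : ℝ}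
    (hσ : 1 < σ) (t : ℝ) :
    (deriv riemannZeta σ / riemannZeta σ).re ≤
      (deriv χ.LFunction (σ + t * I) / χ.LFunction (σ + t * I)).re := by
  set s : ℂ := σ + t * I with hs_def
  have hs : 1 < s.re := by simp [hs_def, hσ]
  have h1 : -(deriv χ.LFunction s / χ.LFunction s) = L (↗χ * ↗Λ) s :=
    DirichletZFR.neg_logDeriv_LFunction_eq χ hs
  have h2 := (DirichletZFR.norm_LSeries_twist_le χ hs).2
  have h3 : (L ↗Λ (σ : ℂ)).re = ∑' n : ℕ, Λ n / (n : ℝ) ^ σ := by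
    rw [DirichletZFR.LSeries_vonMangoldt_ofReal hσ, Complex.ofReal_re]
  have h4 := DirichletZFR.LSeries_vonMangoldt_re_eq hσ
  have hsre : s.re = σ := by simp [hs_def]
  rw [hsre] at h2
  have h5 : (deriv χ.LFunction s / χ.LFunction s).re = -(L (↗χ * ↗Λ) s).re := by
    rw [← h1, Complex.neg_re, neg_neg]
  rw [h5]
  have h6 : (L (↗χ * ↗Λ) s).re ≤ ‖L (↗χ * ↗Λ) s‖ := Complex.re_le_norm _
  have h7 : (deriv riemannZeta σ / riemannZeta σ).re = -(∑' n : ℕ, Λ n / (n : ℝ) ^ σ) := by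
    rw [← h3, h4, Complex.neg_re, neg_neg]
  rw [h7]
  linarith

/-- `Z₀ = Re ζ` is differentiable on `(1, ∞)` with `Z₀'(σ) = Re ζ'(σ)`. [folklore] -/
private theorem hasDerivAt_bigZ {σ : ℝ} (hσ : 1 < σ) : HasDerivAt bigZ (deriv riemannZeta σ).re σ := by
  have hne : (σ : ℂ) ≠ 1 := by
    intro h
    have := congrArg Complex.re h
    simp at this
    linarith
  have hd : HasDerivAt riemannZeta (deriv riemannZeta σ) (σ : ℂ) :=
    (differentiableAt_riemannZeta hne).hasDerivAt
  have h := hd.real_of_complex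
  exact h

/-- `Z₀'(σ) = Re ζ'(σ)` for `σ > 1` (the derivative entering `(Z₀'/Z₀)(σ)` in (4–11)).
[cite: Booker2006, §4 Lemma 4.5 (4–11) p. 396] -/
theorem deriv_bigZ {σ : ℝ} (hσ : 1 < σ) : deriv bigZ σ = (deriv riemannZeta σ).re :=
  (hasDerivAt_bigZ hσ).deriv

/-- **(4–11), lower inequality, in Booker's notation:** `(Z₀'/Z₀)(σ) ≤ Re (L'/L)(σ + it, χ)` for
`σ > 1`. [cite: Booker2006, §4 Lemma 4.5 (4–11) p. 396] -/
theorem logDeriv_bigZ_le_re_logDeriv_LFunction (χ : DirichletCharacter ℂ q) {σ : ℝ} (hσ : 1 < σ)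
    (t : ℝ) :
    deriv bigZ σ / bigZ σ ≤ (deriv χ.LFunction (σ + t * I) / χ.LFunction (σ + t * I)).re := by
  have h := re_logDeriv_zeta_le_re_logDeriv_LFunction χ hσ t
  have hq : deriv bigZ σ / bigZ σ = (deriv riemannZeta σ / riemannZeta σ).re := by
    rw [deriv_bigZ hσ, bigZ, riemannZeta_ofReal_eq_re hσ, Complex.div_ofReal_re, Complex.ofReal_re]
  rw [hq]
  exact h

/-! ### Booker's Lemma 4.5, (4–11), upper inequality, for Dirichlet `L`-functions
(appended 2026-08-26)

"Pairing the terms for `α_{p,j}` and `α'_{p,j}`, we see that each summand is `≤ 0`" — for a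
Dirichlet character the comparison `Re (L'/L)(σ + it, χ) ≤ (z₀'/z₀)(σ) = 2ζ'/ζ(2σ) − ζ'/ζ(σ)`
holds PRIME BY PRIME after summing the geometric series in `k` (it fails term by term over the
prime powers `p^k`, `k` even): with `w = χ(p)p^{−s}`, `x = p^{−σ}`, `|w| ≤ x < 1`,
`Σ_{k≥1} Re w^k = Re w/(1 − w) ≥ −x/(1 + x) = Σ_{k≥1} (2x^{2k} − x^k)`. The regrouping of
`Σ_n Λ(n)χ(n)n^{−s}` over primes is Mathlib's `tsum_eq_tsum_primes_of_support_subset_prime_powers`. -/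

/-- `Σ_{k ≥ 0} w^{k+1} = w/(1 − w)` for `|w| < 1`. [folklore] -/
private theorem tsum_pow_succ_eq {w : ℂ} (hw : ‖w‖ < 1) :
    ∑' k : ℕ, w ^ (k + 1) = w / (1 - w) := by
  have h := tsum_geometric_of_norm_lt_one hw
  simp_rw [pow_succ]
  rw [tsum_mul_right, h, inv_mul_eq_div]

/-- Summability of `k ↦ w^{k+1}` for `|w| < 1`. [folklore] -/
private theorem summable_pow_succ {w : ℂ} (hw : ‖w‖ < 1) : Summable fun k : ℕ ↦ w ^ (k + 1) := by
  simp_rw [pow_succ]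
  exact (summable_geometric_of_norm_lt_one hw).mul_right w

/-- The prime-by-prime inequality behind (4–11): for `|w| ≤ x < 1`,
`Re (w/(1 − w)) ≥ −x/(1 + x)` (`Re (w/(1−w)) = (Re w − |w|²)/|1 − w|²`, minimal at `w = −x`).
[cite: Booker2006, §4 Lemma 4.5 p. 396 (proof: "each summand is ≤ 0")] -/
theorem neg_div_le_re_div_one_sub {w : ℂ} {x : ℝ} (hwx : ‖w‖ ≤ x) (hx1 : x < 1) :
    -(x / (1 + x)) ≤ (w / (1 - w)).re := by
  have hx0 : 0 ≤ x := (norm_nonneg w).trans hwx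
  have hc : -x ≤ w.re := by
    have h1 : |w.re| ≤ ‖w‖ := Complex.abs_re_le_norm w
    have h2 := neg_abs_le w.re
    linarith
  have hc1 : w.re ≤ x := (Complex.re_le_norm w).trans hwx
  have hr2 : w.re ^ 2 + w.im ^ 2 ≤ x ^ 2 := by
    have h : w.re ^ 2 + w.im ^ 2 = ‖w‖ ^ 2 := by
      rw [Complex.sq_norm, Complex.normSq_apply]; ring
    rw [h]
    exact pow_le_pow_left₀ (norm_nonneg w) hwx 2
  have hN : 0 < (1 - w.re) ^ 2 + w.im ^ 2 := by
    have : 0 < 1 - w.re := by linarith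
    positivity
  have hre : (w / (1 - w)).re = (w.re - (w.re ^ 2 + w.im ^ 2)) / ((1 - w.re) ^ 2 + w.im ^ 2) := by
    have hns : Complex.normSq (1 - w) = (1 - w.re) ^ 2 + w.im ^ 2 := by
      rw [Complex.normSq_apply]; simp; ring
    rw [Complex.div_re, hns]
    simp only [Complex.sub_re, Complex.one_re, Complex.sub_im, Complex.one_im, zero_sub]
    rw [← add_div]
    congr 1
    ring
  rw [hre, ← neg_div, div_le_div_iff₀ (by linarith) hN]
  nlinarith [mul_nonneg (sub_nonneg.2 hx1.le) (by linarith : 0 ≤ w.re + x), sq_nonneg w.im]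

/-- `2x²/(1 − x²) − x/(1 − x) = −x/(1 + x)` for `0 ≤ x < 1` (the `θ = 0` case of
`Σ_k (p^{kθ} + p^{−kθ})`-bookkeeping: `(log z₀)' = Σ_p log p · (−x_p/(1 + x_p))`, `x_p = p^{−σ}`).
[cite: Booker2006, §4 Lemma 4.5 p. 396 (proof)] -/
private theorem two_mul_sq_div_sub_div (x : ℝ) (hx0 : 0 ≤ x) (hx1 : x < 1) :
    2 * (x ^ 2 / (1 - x ^ 2)) - x / (1 - x) = -(x / (1 + x)) := by
  have h1 : 1 - x ≠ 0 := by linarith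
  have h2 : 1 + x ≠ 0 := by linarith
  have h3 : 1 - x ^ 2 ≠ 0 := by
    have : 1 - x ^ 2 = (1 - x) * (1 + x) := by ring
    rw [this]; exact mul_ne_zero h1 h2
  field_simp
  ring

/-- **Booker 2006, Lemma 4.5 (4–11), upper inequality, degree one:** for every Dirichlet character
`χ` mod `q`, `σ > 1` and real `t`,
`Re (L'/L)(σ + it, χ) ≤ 2ζ'/ζ(2σ) − ζ'/ζ(σ) = (z₀'/z₀)(σ)` — the logarithmic derivative of
`z₀(σ) = ζ(2σ)/ζ(σ)`. Proof as in the source ("from the Euler product … pairing the terms … each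
summand is `≤ 0`"): regroup `−L'/L(s, χ) = Σ_n Λ(n)χ(n)n^{−s}` and
`−(2ζ'/ζ(2σ) − ζ'/ζ(σ)) = Σ_n Λ(n)(2n^{−2σ} − n^{−σ})` over primes
(`tsum_eq_tsum_primes_of_support_subset_prime_powers`), sum the geometric series in the exponent,
and compare prime by prime with `neg_div_le_re_div_one_sub`.
[cite: Booker2006, §4 Lemma 4.5 (4–11) p. 396] -/
theorem re_logDeriv_LFunction_le (χ : DirichletCharacter ℂ q) {σ : ℝ} (hσ : 1 < σ) (t : ℝ) :
    (deriv χ.LFunction (σ + t * I) / χ.LFunction (σ + t * I)).re ≤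
      2 * (deriv riemannZeta (2 * σ : ℝ) / riemannZeta (2 * σ : ℝ)).re -
        (deriv riemannZeta σ / riemannZeta σ).re := by
  classical
  set s : ℂ := σ + t * I with hs_def
  have hs : 1 < s.re := by simp [hs_def, hσ]
  have hsre : s.re = σ := by simp [hs_def]
  have hs0 : s ≠ 0 := Complex.ne_zero_of_one_lt_re hs
  have hσ0 : (σ : ℂ) ≠ 0 := by exact_mod_cast (show σ ≠ 0 by linarith)
  have hσ2 : ((2 * σ : ℝ) : ℂ) ≠ 0 := by exact_mod_cast (show 2 * σ ≠ 0 by linarith)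
  have h1σ : 1 < (σ : ℂ).re := by simp [hσ]
  have h12σ : 1 < ((2 * σ : ℝ) : ℂ).re := by simp; linarith
  -- the summands
  set D : ℕ →*₀ ℂ := dirichletSummandHom χ hs0 with hD_def
  set Z₁ : ℕ →*₀ ℂ := riemannZetaSummandHom hσ0 with hZ₁_def
  set Z₂ : ℕ →*₀ ℂ := riemannZetaSummandHom hσ2 with hZ₂_def
  have hD_apply : ∀ n : ℕ, D n = χ n * (n : ℂ) ^ (-s) := fun n ↦ rfl
  have hZ₁_apply : ∀ n : ℕ, Z₁ n = (n : ℂ) ^ (-(σ : ℂ)) := fun n ↦ rfl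
  have hZ₂_apply : ∀ n : ℕ, Z₂ n = (n : ℂ) ^ (-((2 * σ : ℝ) : ℂ)) := fun n ↦ rfl
  set f : ℕ → ℂ := fun n ↦ (Λ n : ℂ) * D n with hf_def
  set g : ℕ → ℂ := fun n ↦ (Λ n : ℂ) * (2 * Z₂ n - Z₁ n) with hg_def
  -- identification with the `L`-series terms
  have hf_term : f = LSeries.term (↗χ * ↗Λ) s := by
    funext n
    rcases eq_or_ne n 0 with rfl | hn
    · simp [hf_def]
    · rw [LSeries.term_of_ne_zero hn, hf_def]
      simp only [hD_apply, Pi.mul_apply, Complex.cpow_neg, div_eq_mul_inv]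
      ring
  have hΛterm : ∀ {u : ℂ} (n : ℕ), (Λ n : ℂ) * (n : ℂ) ^ (-u) =
      LSeries.term (fun m : ℕ ↦ (Λ m : ℂ)) u n := by
    intro u n
    rcases eq_or_ne n 0 with rfl | hn
    · simp
    · rw [LSeries.term_of_ne_zero hn, Complex.cpow_neg, div_eq_mul_inv]
  have hg_term : g = fun n ↦ 2 * LSeries.term (fun m : ℕ ↦ (Λ m : ℂ)) ((2 * σ : ℝ) : ℂ) n -
      LSeries.term (fun m : ℕ ↦ (Λ m : ℂ)) (σ : ℂ) n := by
    funext n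
    rw [hg_def]
    simp only [hZ₁_apply, hZ₂_apply]
    rw [← hΛterm, ← hΛterm]
    ring
  -- summability and values
  have hf_sum : Summable f := by
    rw [hf_term]; exact DirichletCharacter.LSeriesSummable_twist_vonMangoldt χ hs
  have hΛ1 : Summable (LSeries.term (fun m : ℕ ↦ (Λ m : ℂ)) (σ : ℂ)) :=
    ArithmeticFunction.LSeriesSummable_vonMangoldt h1σ
  have hΛ2 : Summable (LSeries.term (fun m : ℕ ↦ (Λ m : ℂ)) ((2 * σ : ℝ) : ℂ)) :=
    ArithmeticFunction.LSeriesSummable_vonMangoldt h12σ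
  have hg_sum : Summable g := by
    rw [hg_term]; exact (hΛ2.mul_left 2).sub hΛ1
  have hf_tsum : ∑' n, f n = -(deriv χ.LFunction s / χ.LFunction s) := by
    rw [hf_term, DirichletZFR.neg_logDeriv_LFunction_eq χ hs]
    rfl
  have hg_tsum : ∑' n, g n = 2 * L ↗Λ ((2 * σ : ℝ) : ℂ) - L ↗Λ (σ : ℂ) := by
    rw [hg_term, (hΛ2.mul_left 2).tsum_sub hΛ1, tsum_mul_left]
    rfl
  have hg_tsum_re : (∑' n, g n).re =
      -(2 * (deriv riemannZeta (2 * σ : ℝ) / riemannZeta (2 * σ : ℝ)).re -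
        (deriv riemannZeta σ / riemannZeta σ).re) := by
    rw [hg_tsum, ArithmeticFunction.LSeries_vonMangoldt_eq_deriv_riemannZeta_div h12σ,
      ArithmeticFunction.LSeries_vonMangoldt_eq_deriv_riemannZeta_div h1σ]
    simp only [Complex.sub_re, Complex.mul_re, Complex.neg_re, neg_div]
    norm_num
    ring
  -- supports in the prime powers
  have hΛ0 : ∀ n : ℕ, ¬ IsPrimePow n → (Λ n : ℂ) = 0 := fun n hn ↦ by
    rw [ArithmeticFunction.vonMangoldt_eq_zero_iff.2 hn, Complex.ofReal_zero]
  have hf_supp : Function.support f ⊆ {n | IsPrimePow n} := by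
    intro n hn
    by_contra hnp
    exact hn (by simp only [hf_def, hΛ0 n hnp, zero_mul])
  have hg_supp : Function.support g ⊆ {n | IsPrimePow n} := by
    intro n hn
    by_contra hnp
    exact hn (by simp only [hg_def, hΛ0 n hnp, zero_mul])
  -- regrouping over primes
  have hf_re : ∑' n, f n = ∑' (p : Nat.Primes) (k : ℕ), f (p ^ (k + 1)) :=
    tsum_eq_tsum_primes_of_support_subset_prime_powers hf_sum hf_supp
  have hg_re : ∑' n, g n = ∑' (p : Nat.Primes) (k : ℕ), g (p ^ (k + 1)) :=
    tsum_eq_tsum_primes_of_support_subset_prime_powers hg_sum hg_supp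
  have hfm' : Summable fun pk : Nat.Primes × ℕ ↦ f (pk.1 ^ (pk.2 + 1)) := by
    have h := (Nat.Primes.prodNatEquiv.summable_iff (f := f ∘ Subtype.val)).mpr (hf_sum.subtype _)
    refine h.congr fun pk ↦ ?_
    obtain ⟨p, k⟩ := pk
    simp only [Function.comp_apply, Nat.Primes.coe_prodNatEquiv_apply]
  have hgm' : Summable fun pk : Nat.Primes × ℕ ↦ g (pk.1 ^ (pk.2 + 1)) := by
    have h := (Nat.Primes.prodNatEquiv.summable_iff (f := g ∘ Subtype.val)).mpr (hg_sum.subtype _)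
    refine h.congr fun pk ↦ ?_
    obtain ⟨p, k⟩ := pk
    simp only [Function.comp_apply, Nat.Primes.coe_prodNatEquiv_apply]
  have hA_sum : Summable fun p : Nat.Primes ↦ ∑' k : ℕ, f (p ^ (k + 1)) := hfm'.prod
  have hB_sum : Summable fun p : Nat.Primes ↦ ∑' k : ℕ, g (p ^ (k + 1)) := hgm'.prod
  -- values on prime powers
  have hlog : ∀ (p : Nat.Primes) (k : ℕ), (Λ ((p : ℕ) ^ (k + 1)) : ℂ) = (Real.log p : ℂ) := by
    intro p k
    rw [ArithmeticFunction.vonMangoldt_apply_pow (Nat.succ_ne_zero k),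
      ArithmeticFunction.vonMangoldt_apply_prime p.prop]
  have hfpk : ∀ (p : Nat.Primes) (k : ℕ),
      f ((p : ℕ) ^ (k + 1)) = (Real.log p : ℂ) * (D p) ^ (k + 1) := by
    intro p k
    show (Λ ((p : ℕ) ^ (k + 1)) : ℂ) * D ((p : ℕ) ^ (k + 1)) = _
    rw [hlog, map_pow D]
  have hgpk : ∀ (p : Nat.Primes) (k : ℕ),
      g ((p : ℕ) ^ (k + 1)) = (Real.log p : ℂ) * (2 * (Z₂ p) ^ (k + 1) - (Z₁ p) ^ (k + 1)) := by
    intro p k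
    show (Λ ((p : ℕ) ^ (k + 1)) : ℂ) * (2 * Z₂ ((p : ℕ) ^ (k + 1)) - Z₁ ((p : ℕ) ^ (k + 1))) = _
    rw [hlog, map_pow Z₂, map_pow Z₁]
  -- the local data `x = p^{-σ}`, `|D p| ≤ x < 1`, `Z₁ p = x`, `Z₂ p = x²`
  have hx1 : ∀ p : Nat.Primes, ((p : ℕ) : ℝ) ^ (-σ) < 1 := fun p ↦
    Real.rpow_lt_one_of_one_lt_of_neg (by exact_mod_cast p.prop.one_lt) (by linarith)
  have hx0 : ∀ p : Nat.Primes, 0 ≤ ((p : ℕ) : ℝ) ^ (-σ) := fun p ↦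
    Real.rpow_nonneg (Nat.cast_nonneg _) _
  have hDle : ∀ p : Nat.Primes, ‖D p‖ ≤ ((p : ℕ) : ℝ) ^ (-σ) := by
    intro p
    rw [hD_apply, norm_mul, Complex.norm_natCast_cpow_of_pos p.prop.pos, Complex.neg_re, hsre]
    calc ‖χ (p : ℕ)‖ * ((p : ℕ) : ℝ) ^ (-σ) ≤ 1 * ((p : ℕ) : ℝ) ^ (-σ) :=
          mul_le_mul_of_nonneg_right (DirichletCharacter.norm_le_one χ _) (hx0 p)
      _ = ((p : ℕ) : ℝ) ^ (-σ) := one_mul _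
  have hD1 : ∀ p : Nat.Primes, ‖D p‖ < 1 := fun p ↦ (hDle p).trans_lt (hx1 p)
  have hZ₁x : ∀ p : Nat.Primes, Z₁ p = ((((p : ℕ) : ℝ) ^ (-σ) : ℝ) : ℂ) := by
    intro p
    rw [hZ₁_apply, Complex.ofReal_cpow (Nat.cast_nonneg _) (-σ)]
    push_cast
    rfl
  have hZ₂x : ∀ p : Nat.Primes, Z₂ p = (((((p : ℕ) : ℝ) ^ (-σ)) ^ 2 : ℝ) : ℂ) := by
    intro p
    have hsq : ((p : ℕ) : ℝ) ^ (-(2 * σ)) = (((p : ℕ) : ℝ) ^ (-σ)) ^ 2 := by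
      rw [show (-(2 * σ)) = (-σ) * 2 by ring, Real.rpow_mul (Nat.cast_nonneg _)]
      norm_cast
    rw [hZ₂_apply, ← hsq, Complex.ofReal_cpow (Nat.cast_nonneg _) (-(2 * σ))]
    push_cast
    rfl
  have hZ₁n : ∀ p : Nat.Primes, ‖Z₁ p‖ < 1 := by
    intro p; rw [hZ₁x, Complex.norm_real, Real.norm_of_nonneg (hx0 p)]; exact hx1 p
  have hZ₂n : ∀ p : Nat.Primes, ‖Z₂ p‖ < 1 := by
    intro p
    rw [hZ₂x, Complex.norm_real, Real.norm_of_nonneg (sq_nonneg _)]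
    exact pow_lt_one₀ (hx0 p) (hx1 p) two_ne_zero
  -- the inner sums in closed form
  have hA : ∀ p : Nat.Primes, ∑' k : ℕ, f ((p : ℕ) ^ (k + 1)) =
      (Real.log p : ℂ) * (D p / (1 - D p)) := by
    intro p
    simp_rw [hfpk]
    rw [tsum_mul_left, tsum_pow_succ_eq (hD1 p)]
  have hB : ∀ p : Nat.Primes, ∑' k : ℕ, g ((p : ℕ) ^ (k + 1)) =
      (Real.log p : ℂ) * (2 * (Z₂ p / (1 - Z₂ p)) - Z₁ p / (1 - Z₁ p)) := by
    intro p
    simp_rw [hgpk]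
    rw [tsum_mul_left, ((summable_pow_succ (hZ₂n p)).mul_left 2).tsum_sub (summable_pow_succ (hZ₁n p)),
      tsum_mul_left, tsum_pow_succ_eq (hZ₂n p), tsum_pow_succ_eq (hZ₁n p)]
  -- prime-by-prime comparison of real parts
  have hpt : ∀ p : Nat.Primes,
      (∑' k : ℕ, g ((p : ℕ) ^ (k + 1))).re ≤ (∑' k : ℕ, f ((p : ℕ) ^ (k + 1))).re := by
    intro p
    rw [hA, hB, Complex.re_ofReal_mul, Complex.re_ofReal_mul]
    have hlogp : 0 ≤ Real.log p := Real.log_nonneg (by exact_mod_cast p.prop.one_lt.le)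
    refine mul_le_mul_of_nonneg_left ?_ hlogp
    have hBre : (2 * (Z₂ p / (1 - Z₂ p)) - Z₁ p / (1 - Z₁ p)).re =
        2 * ((((p : ℕ) : ℝ) ^ (-σ)) ^ 2 / (1 - (((p : ℕ) : ℝ) ^ (-σ)) ^ 2)) -
          ((p : ℕ) : ℝ) ^ (-σ) / (1 - ((p : ℕ) : ℝ) ^ (-σ)) := by
      rw [hZ₁x, hZ₂x]
      have h : (2 * (((((((p : ℕ) : ℝ) ^ (-σ)) ^ 2 : ℝ)) : ℂ) /
            (1 - ((((((p : ℕ) : ℝ) ^ (-σ)) ^ 2 : ℝ)) : ℂ))) -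
            (((((p : ℕ) : ℝ) ^ (-σ) : ℝ)) : ℂ) / (1 - (((((p : ℕ) : ℝ) ^ (-σ) : ℝ)) : ℂ))) =
          ((2 * ((((p : ℕ) : ℝ) ^ (-σ)) ^ 2 / (1 - (((p : ℕ) : ℝ) ^ (-σ)) ^ 2)) -
            ((p : ℕ) : ℝ) ^ (-σ) / (1 - ((p : ℕ) : ℝ) ^ (-σ)) : ℝ) : ℂ) := by
        push_cast; ring
      rw [h, Complex.ofReal_re]
    rw [hBre, two_mul_sq_div_sub_div _ (hx0 p) (hx1 p)]
    exact neg_div_le_re_div_one_sub (hDle p) (hx1 p)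
  -- assemble
  have hAre : Summable fun p : Nat.Primes ↦ (∑' k : ℕ, f ((p : ℕ) ^ (k + 1))).re := by
    simpa only [Complex.reCLM_apply] using Complex.reCLM.summable hA_sum
  have hBre : Summable fun p : Nat.Primes ↦ (∑' k : ℕ, g ((p : ℕ) ^ (k + 1))).re := by
    simpa only [Complex.reCLM_apply] using Complex.reCLM.summable hB_sum
  have hcmp : (∑' n, g n).re ≤ (∑' n, f n).re := by
    rw [hf_re, hg_re, Complex.re_tsum hA_sum, Complex.re_tsum hB_sum]
    exact Summable.tsum_le_tsum hpt hBre hAre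
  rw [hg_tsum_re, hf_tsum, Complex.neg_re] at hcmp
  linarith

/-- `z₀ = Z₀(2σ)/Z₀(σ)` is differentiable on `(1, ∞)` with logarithmic derivative
`(z₀'/z₀)(σ) = 2ζ'/ζ(2σ) − ζ'/ζ(σ)` (real parts; `ζ` is real on the real axis beyond `1`).
[cite: Booker2006, §4 Lemma 4.5 (4–11) p. 396] -/
theorem deriv_smallZ_div_smallZ {σ : ℝ} (hσ : 1 < σ) :
    deriv smallZ σ / smallZ σ =
      2 * (deriv riemannZeta (2 * σ : ℝ) / riemannZeta (2 * σ : ℝ)).re -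
        (deriv riemannZeta σ / riemannZeta σ).re := by
  -- `smallZ = (bigZ ∘ (2·)) / bigZ` on the open set `(1, ∞)`
  have hev : smallZ =ᶠ[𝓝 σ] fun u ↦ bigZ (2 * u) / bigZ u := by
    filter_upwards [Ioi_mem_nhds hσ] with u hu using smallZ_eq_div hu
  have h2σ : 1 < 2 * σ := by linarith
  have hb2 : HasDerivAt (fun u : ℝ ↦ bigZ (2 * u)) ((deriv riemannZeta (2 * σ : ℝ)).re * 2) σ := by
    have h := hasDerivAt_bigZ h2σ
    have hlin : HasDerivAt (fun u : ℝ ↦ 2 * u) 2 σ := by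
      simpa using (hasDerivAt_id σ).const_mul (2 : ℝ)
    exact h.comp σ hlin
  have hb1 : HasDerivAt bigZ (deriv riemannZeta σ).re σ := hasDerivAt_bigZ hσ
  have hne1 : bigZ σ ≠ 0 := (bigZ_pos hσ).ne'
  have hne2 : bigZ (2 * σ) ≠ 0 := (bigZ_pos h2σ).ne'
  have hq : HasDerivAt (fun u : ℝ ↦ bigZ (2 * u) / bigZ u)
      (((deriv riemannZeta (2 * σ : ℝ)).re * 2 * bigZ σ - bigZ (2 * σ) * (deriv riemannZeta σ).re) /
        bigZ σ ^ 2) σ := hb2.div hb1 hne1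
  rw [hev.deriv_eq, hq.deriv, smallZ_eq_div hσ]
  -- real parts of the complex logarithmic derivatives
  have hr1 : (deriv riemannZeta σ / riemannZeta σ).re = (deriv riemannZeta σ).re / bigZ σ := by
    rw [bigZ, riemannZeta_ofReal_eq_re hσ, Complex.div_ofReal_re, Complex.ofReal_re]
  have hr2 : (deriv riemannZeta (2 * σ : ℝ) / riemannZeta (2 * σ : ℝ)).re =
      (deriv riemannZeta (2 * σ : ℝ)).re / bigZ (2 * σ) := by
    rw [bigZ, riemannZeta_ofReal_eq_re h2σ, Complex.div_ofReal_re, Complex.ofReal_re]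
  rw [hr1, hr2]
  field_simp

/-- **(4–11), upper inequality, in Booker's notation:** `Re (L'/L)(σ + it, χ) ≤ (z₀'/z₀)(σ)` for
`σ > 1`. Together with `logDeriv_bigZ_le_re_logDeriv_LFunction` this is the whole of (4–11) for a
Dirichlet `L`-function (`r = 1`, `θ = 0`). [cite: Booker2006, §4 Lemma 4.5 (4–11) p. 396] -/
theorem re_logDeriv_LFunction_le_logDeriv_smallZ (χ : DirichletCharacter ℂ q) {σ : ℝ} (hσ : 1 < σ)
    (t : ℝ) :
    (deriv χ.LFunction (σ + t * I) / χ.LFunction (σ + t * I)).re ≤ deriv smallZ σ / smallZ σ := by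
  rw [deriv_smallZ_div_smallZ hσ]
  exact re_logDeriv_LFunction_le χ hσ t

/-- **Booker 2006, Lemma 4.5 (4–11) for Dirichlet `L`-functions, both inequalities:**
`(Z₀'/Z₀)(σ) ≤ Re (L'/L)(σ + it, χ) ≤ (z₀'/z₀)(σ)` for `σ > 1`.
[cite: Booker2006, §4 Lemma 4.5 (4–11) p. 396] -/
theorem logDeriv_envelope (χ : DirichletCharacter ℂ q) {σ : ℝ} (hσ : 1 < σ) (t : ℝ) :
    deriv bigZ σ / bigZ σ ≤ (deriv χ.LFunction (σ + t * I) / χ.LFunction (σ + t * I)).re ∧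
      (deriv χ.LFunction (σ + t * I) / χ.LFunction (σ + t * I)).re ≤ deriv smallZ σ / smallZ σ :=
  ⟨logDeriv_bigZ_le_re_logDeriv_LFunction χ hσ t, re_logDeriv_LFunction_le_logDeriv_smallZ χ hσ t⟩

end Booker2006Turing

end Literature.NumberTheory.LFunctions

end
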